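import Literature.NumberTheory.NumberFields.EquivariantIwasawaLemmaInertia
import Literature.NumberTheory.NumberFields.ClassGroupRankEqualityCosetKernel
import Literature.RepresentationTheory.FiniteGroups.CosetKernelModuleLift
import Literature.RepresentationTheory.FiniteGroups.EquivariantHomNilpotentUpgrade
import Literature.GroupTheory.FiniteAbelian.HomCounts
import HarnessLib

/-!
# The RANK-EQUALITY TRANSFER along the cyclotomic tower: equal `p`-torsion counts of `Cl(L₀^H)` and `Cl(L₀^{H′})`
# persist to all layers `L₀K_n` (equivariant Iwasawa lemma + Frobenius reciprocity + Nakayama; no named fact)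

Topic `NumberTheory/NumberFields` (namespace = path, grouping sub-namespace `RankEqualityTransfer`).  THEOREM-ONLY file
(no definition, no named fact, no `sorry`), written by the prover seat `bsd-potss-k8t-c4` g25 (cell `bsd-potss`; `--supports`
stmt-BirchSwinnertonDyer-19982, the U₀ node of route K8-t′ `KatoDescentTamePotSupersingular`; closes nothing; neither BSD nor
Coates–Sujatha's Conjecture A is proved for any curve here).

## Setting and statement

`k` a number field, `p` an odd prime, `κ` a `ℤ_p`-extension of `k` with layers `K_n` and a maximal ideal of `ℤ̄_k` totally
ramified in `K_∞/k` (for `k = ℚ`, `κ` cyclotomic: tree `exists_isMaximal_inertia_sup_kerSubgroup_eq_top_of_isCyclotomic`);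
`L₀ ⊆ k̄` finite Galois over `k`, `G = Gal(L₀/k)`, `p ∤ #G`; `H ≤ H′ ≤ G` (so `p ∤ #H′`); `L_n = L₀ ⊔ K_n`, `Γ_n = Gal(k̄/K_n)`
(`κ.layerSubgroup n`), and `H̃_n, H̃′_n ≤ Gal(L_n/k)` the images of `{τ ∈ Γ_n : τ|_{L₀} ∈ H}` (resp. `H′`) — their fixed fields
are the layers `L₀^H K_n`, `L₀^{H′} K_n` of the leaves.  HYPOTHESES: (rank) `#Cl(L₀^H)[p] = #Cl(L₀^{H′})[p]`; (inertia) for every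
prime `𝔮 ∋ p` of `L₀` the inertia group `I(𝔮) ≤ G` acts transitively on `G/H` (`G = I(𝔮)·H`).  CONCLUSION
(`natCard_torsion_classGroup_fixedField_layer_eq`): for every `n`, `#Cl(L_n^{H̃_n})[p] = #Cl(L_n^{H̃′_n})[p]`.

## Proof (assembled from the tree)

* `V = C(G; H ≤ H′) = cosetKernel H H′ (ℤ/p)` with `Γ_k` acting through `τ ↦ τ|_{L₀}`.  (c2*): by (rank) and
  `ClassGroupRankEqualityCosetKernel.equivariantHom_cosetKernel_eq_zero_of_natCard_torsion_eq` every `G`-equivariant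
  `Cl(L₀) → V` vanishes.  (c3*-I): by (inertia) and `CosetKernelModuleLift.eq_zero_of_forall_smul_eq_of_transitive`,
  `V^{I(𝔮)} = 0`.  DOOR L6 (`EquivariantIwasawaLemmaInertia…_of_inertia`): every `Γ_k`-equivariant `Cl(L_n) → V` vanishes.
* UPGRADE (`EquivariantHomNilpotentUpgrade`): with `γ̃ ∈ Γ_k`, `γ̃|_{L₀} = 1`, `κ(γ̃) = #G` — `Γ_k = Γ_n · γ̃^ℕ` on `L_n`,
  `γ̃` central on `L_n`, `γ̃^{pⁿ}` trivial on `L_n` — every `Γ_n`-equivariant `Cl(L_n) → V` vanishes.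
* FROBENIUS (`CosetKernelModuleLift.invariant_lift_of_forall_equivariantHom_eq_zero`, `π = (·)|_{L₀} : Γ_n ↠ G`): every
  `H̃_n`-invariant `𝔽_p`-character of `Cl(L_n)` is `H̃′_n`-invariant; COUNT (`ClassGroupFixedHomDescent`, `HomCounts`):
  `#Cl(L_n^{H̃_n})[p] = #{H̃_n-invariant characters} = #{H̃′_n-invariant characters} = #Cl(L_n^{H̃′_n})[p]`.

This is the isotypic reading of Iwasawa's 1956 argument («no new isotypic component of `Cl(L_n)/p` is born up the tower»)
in the rank currency of the cell's μ-road census: with `ClassicalMuVanishesIffBoundedRank` it gives `μ_p(L₀^H) = 0 ⟺ μ_p(L₀^{H′}) = 0`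
once the layers `L_n^{H̃_n}` are identified with the layers of the cyclotomic `ℤ_p`-extension of `L₀^H` (consumer step, not here).

## References

* L. C. Washington, *Introduction to Cyclotomic Fields*, 2nd ed., GTM 83 (1997), §13.1–13.3, Thm. 10.4. [Washington1997]
* J. Neukirch, *Algebraic Number Theory* (1999), Ch. III §1 Prop. (1.6). [NeukirchANT1999]
* J.-P. Serre, *Linear Representations of Finite Groups*, GTM 42, §7.2 Thm. 13. [SerreLinearRepresentations1977]
-/

noncomputable section

open scoped Pointwise nonZeroDivisors
open NumberField Field IntermediateField Ideal IsDedekindDomain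
open Literature.NumberTheory.GaloisRepresentations
open Literature.NumberTheory.EllipticCurves (ringOfIntegersToIntegralClosure ZpExtension)
open Literature.RepresentationTheory.FiniteGroups Literature.GroupTheory.FiniteAbelian

namespace Literature.NumberTheory.NumberFields

namespace RankEqualityTransfer

variable {k : Type} [Field k]

/-! ### Helpers on restrictions `τ ↦ τ|_E` (as in the `EquivariantIwasawaLemma` files) -/

/-- `((τ|_E) x : k̄) = τ • x`. [folklore] -/
private theorem coe_absRestrictNormalHom_apply₄ (E : IntermediateField k (AlgebraicClosure k))
    [Normal k E] (τ : absoluteGaloisGroup k) (x : E) :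
    ((absRestrictNormalHom E τ x : E) : AlgebraicClosure k) = τ • (x : AlgebraicClosure k) :=
  AlgEquiv.restrictNormalHom_apply E _ x

/-- `τ|_E = 1` iff `τ ∈ Gal(k̄/E)`. [folklore] -/
private theorem absRestrictNormalHom_eq_one_iff_mem_fixingSubgroup₄
    (E : IntermediateField k (AlgebraicClosure k)) [Normal k E] (τ : absoluteGaloisGroup k) :
    absRestrictNormalHom E τ = 1 ↔ absoluteGaloisGroup.toAlgEquiv k τ ∈ E.fixingSubgroup := by
  rw [IntermediateField.mem_fixingSubgroup_iff]
  constructor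
  · intro h x hx
    change τ • x = x
    rw [← coe_absRestrictNormalHom_apply₄ E τ ⟨x, hx⟩, h, AlgEquiv.one_apply]
  · intro h
    ext x
    rw [coe_absRestrictNormalHom_apply₄ E τ x, AlgEquiv.one_apply]
    exact h x x.2

/-- `τ|_{E₁E₂} = 1 ↔ τ|_{E₁} = 1 ∧ τ|_{E₂} = 1`. [folklore] -/
private theorem absRestrictNormalHom_sup_eq_one_iff₄ (E₁ E₂ : IntermediateField k (AlgebraicClosure k))
    [Normal k E₁] [Normal k E₂] (τ : absoluteGaloisGroup k) :
    absRestrictNormalHom (E₁ ⊔ E₂ : IntermediateField k (AlgebraicClosure k)) τ = 1 ↔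
      absRestrictNormalHom E₁ τ = 1 ∧ absRestrictNormalHom E₂ τ = 1 := by
  rw [absRestrictNormalHom_eq_one_iff_mem_fixingSubgroup₄, absRestrictNormalHom_eq_one_iff_mem_fixingSubgroup₄,
    absRestrictNormalHom_eq_one_iff_mem_fixingSubgroup₄, IntermediateField.fixingSubgroup_sup, Subgroup.mem_inf]

/-- `(στ)|_{E₁E₂} = (σ'τ')|_{E₁E₂}` from equality on `E₁` and on `E₂`: `σ|_{E₁E₂} = σ'|_{E₁E₂} ↔ …`. [folklore] -/
private theorem absRestrictNormalHom_sup_eq_iff₄ (E₁ E₂ : IntermediateField k (AlgebraicClosure k))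
    [Normal k E₁] [Normal k E₂] (σ τ : absoluteGaloisGroup k) :
    absRestrictNormalHom (E₁ ⊔ E₂ : IntermediateField k (AlgebraicClosure k)) σ =
        absRestrictNormalHom (E₁ ⊔ E₂ : IntermediateField k (AlgebraicClosure k)) τ ↔
      absRestrictNormalHom E₁ σ = absRestrictNormalHom E₁ τ ∧ absRestrictNormalHom E₂ σ = absRestrictNormalHom E₂ τ := by
  rw [← inv_mul_eq_one, ← map_inv, ← map_mul, absRestrictNormalHom_sup_eq_one_iff₄, map_mul, map_inv, map_mul, map_inv,
    inv_mul_eq_one, inv_mul_eq_one]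

variable [NumberField k] {p : ℕ} [hp : Fact p.Prime]

/-- `g|_{K_m} = 1 ↔ g ∈ κ⁻¹(pᵐℤ_p)`. [folklore] -/
private theorem absRestrictNormalHom_layer_eq_one_iff₄ (κ : ZpExtension k p) (m : ℕ) [Normal k (κ.layer m)]
    (g : absoluteGaloisGroup k) : absRestrictNormalHom (κ.layer m) g = 1 ↔ g ∈ κ.layerSubgroup m := by
  rw [absRestrictNormalHom_eq_one_iff_mem_fixingSubgroup₄, κ.fixingSubgroup_layer m]
  constructor
  · rintro ⟨g', hg', hgg'⟩
    have : g' = g := (absoluteGaloisGroup.toAlgEquiv k).injective hgg'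
    exact this ▸ hg'
  · exact fun h => ⟨g, h, rfl⟩

/-! ### The element `γ̃` with `γ̃|_{L₀} = 1`, `κ(γ̃) = [L₀ : k]` -/

omit [NumberField k] in
/-- There is `γ̃ ∈ Γ_k` with `γ̃|_{L₀} = 1` and `κ(γ̃) = [L₀ : k]` (a `[L₀:k]`-th power of any `γ` with `κ(γ) = 1`).
[folklore] -/
private theorem exists_restrict_eq_one_toAdd_eq (κ : ZpExtension k p)
    (L₀ : IntermediateField k (AlgebraicClosure k)) [FiniteDimensional k L₀] [IsGalois k L₀] :
    ∃ γ₁ : absoluteGaloisGroup k, absRestrictNormalHom L₀ γ₁ = 1 ∧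
      (κ γ₁).toAdd = (Module.finrank k L₀ : ℤ_[p]) := by
  obtain ⟨γ, hγ⟩ := κ.surjective (Multiplicative.ofAdd 1)
  rw [ZpExtension.coe_toContinuousMonoidHom] at hγ
  have hγ1 : (κ γ).toAdd = 1 := by rw [hγ]; rfl
  refine ⟨γ ^ Module.finrank k L₀, ?_, ?_⟩
  · rw [map_pow, ← IsGalois.card_aut_eq_finrank, pow_card_eq_one']
  · rw [map_pow, toAdd_pow, hγ1, nsmul_eq_mul, mul_one]

omit [NumberField k] in
/-- `Γ_k = Γ_n · γ̃^ℕ`: for `κ(γ̃) = m` with `p ∤ m`, every `τ ∈ Γ_k` is `τ₁ γ̃^t` with `τ₁ ∈ κ⁻¹(pⁿℤ_p)`. [folklore] -/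
private theorem exists_mul_pow_inv_mem_layerSubgroup (κ : ZpExtension k p) {m : ℕ} (hm : ¬ p ∣ m)
    {γ₁ : absoluteGaloisGroup k} (hγ₁ : (κ γ₁).toAdd = (m : ℤ_[p])) (n : ℕ) (τ : absoluteGaloisGroup k) :
    ∃ t : ℕ, τ * (γ₁ ^ t)⁻¹ ∈ κ.layerSubgroup n := by
  have hpr : p.Prime := hp.out
  set a : ℤ_[p] := (κ τ).toAdd with hadef
  set a₀ : ℕ := PadicInt.appr a n with ha₀def
  have ha₀ : (p : ℤ_[p]) ^ n ∣ a - a₀ := Ideal.mem_span_singleton.mp (PadicInt.appr_spec n a)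
  have hcop : Nat.Coprime m (p ^ n) := (Nat.coprime_comm.mp (hpr.coprime_iff_not_dvd.mpr hm)).pow_right _
  obtain ⟨t, -, ht⟩ := Nat.exists_mul_mod_eq_of_coprime a₀ hcop (pow_ne_zero _ hpr.ne_zero)
  have hmt : (p : ℤ_[p]) ^ n ∣ (a₀ : ℤ_[p]) - ((m * t : ℕ) : ℤ_[p]) := by
    have h1 := map_dvd (Int.castRingHom ℤ_[p]) (Nat.modEq_iff_dvd.mp ht)
    push_cast at h1
    exact_mod_cast h1
  refine ⟨t, ?_⟩
  rw [ZpExtension.mem_layerSubgroup, map_mul, map_inv, map_pow, toAdd_mul, toAdd_inv, toAdd_pow, hγ₁, nsmul_eq_mul]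
  have e : a + -((t : ℤ_[p]) * (m : ℤ_[p])) = (a - a₀) + ((a₀ : ℤ_[p]) - ((m * t : ℕ) : ℤ_[p])) := by
    push_cast; ring
  rw [e]
  exact dvd_add ha₀ hmt

/-- Restriction `Γ_k → Gal(E/k)` is onto. [folklore] -/
private theorem absRestrictNormalHom_surjective₄ (E : IntermediateField k (AlgebraicClosure k)) [Normal k E] :
    Function.Surjective (absRestrictNormalHom E) := fun g => by
  obtain ⟨σ, hσ⟩ := AlgEquiv.restrictNormalHom_surjective (AlgebraicClosure k) g
  exact ⟨(Field.absoluteGaloisGroup.toAlgEquiv k).symm σ, hσ⟩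

/-- `p ∤ #S` makes `#S` injective on `ℤ/p`. [folklore] -/
private theorem zmod_card_nsmul_injective₄ {S : Type*} [Fintype S] (hpS : ¬ p ∣ Fintype.card S) (r : ZMod p)
    (hr : Fintype.card S • r = 0) : r = 0 := by
  rw [nsmul_eq_mul] at hr
  have hne : ((Fintype.card S : ℕ) : ZMod p) ≠ 0 := by
    rw [Ne, ZMod.natCast_eq_zero_iff]; exact hpS
  exact (mul_eq_zero.mp hr).resolve_left hne

/-! ### Door L6 for `V = C(G; H ≤ H′)`: the `Γ_k`-equivariant characters of `Cl(L₀K_n)` with values in `C` vanish -/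

set_option maxHeartbeats 1600000 in
set_option synthInstance.maxHeartbeats 200000 in
/-- **The `Γ_k`-equivariant additive maps `Cl(L₀K_n) → C(G; H ≤ H′)` vanish**, for `L₀/k` with `p ∤ [L₀:k]`, `H ≤ H′ ≤ G = Gal(L₀/k)`,
`p ∤ #H′`, under (rank) `#Cl(L₀^H)[p] = #Cl(L₀^{H′})[p]` and (inertia) `G = I(𝔮)·H` for the primes `𝔮 ∋ p` of `L₀`; `Γ_k` acts on
`C = cosetKernel H H′ (ℤ/p)` through `τ ↦ τ|_{L₀}`.  (Door L6 in inertia form, `EquivariantIwasawaLemmaInertia`, with (c2*) from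
`equivariantHom_cosetKernel_eq_zero_of_natCard_torsion_eq` and (c3*-I) from `eq_zero_of_forall_smul_eq_of_transitive`.)
[cite: Washington1997, §13.3 Lemmas 13.14–13.15 and Thm. 10.4 (proof)] [cite: SerreLinearRepresentations1977, §7.2 Thm. 13 (Frobenius reciprocity)] -/
theorem equivariantHom_cosetKernel_layer_eq_zero (hp2 : p ≠ 2) (κ : ZpExtension k p)
    (L₀ : IntermediateField k (AlgebraicClosure k)) [FiniteDimensional k L₀] [IsGalois k L₀]
    (hL₀ : ¬ p ∣ Module.finrank k L₀)
    [∀ n, FiniteDimensional k (κ.layer n)] [∀ n, IsGalois k (κ.layer n)]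
    [∀ n, NumberField (L₀ ⊔ κ.layer n : IntermediateField k (AlgebraicClosure k))]
    (hram : ∃ 𝔓' : Ideal (absIntegers (𝓞 k) k), 𝔓'.IsMaximal ∧
      𝔓'.inertia (absoluteGaloisGroup k) ⊔ κ.kerSubgroup = ⊤)
    (H H' : Subgroup (L₀ ≃ₐ[k] L₀)) (hHH' : H ≤ H') [Fintype H] [Fintype H'] (hpH' : ¬ p ∣ Fintype.card H')
    [NumberField L₀]
    (hrank : Nat.card {d : ClassGroup (𝓞 ↥(fixedField H)) // d ^ p = 1} =
      Nat.card {d : ClassGroup (𝓞 ↥(fixedField H')) // d ^ p = 1})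
    (hI : ∀ (𝔮 : Ideal (𝓞 L₀)) [𝔮.IsMaximal], ((p : ℕ) : 𝓞 L₀) ∈ 𝔮 →
      ∀ g : L₀ ≃ₐ[k] L₀, ∃ i ∈ 𝔮.inertia (L₀ ≃ₐ[k] L₀), ∃ h ∈ H, g = i * h)
    (n : ℕ)
    (f : Additive (ClassGroup (𝓞 (L₀ ⊔ κ.layer n : IntermediateField k (AlgebraicClosure k)))) →+
      cosetKernel H H' (ZMod p))
    (hf : ∀ (τ : absoluteGaloisGroup k)
        (c : ClassGroup (𝓞 (L₀ ⊔ κ.layer n : IntermediateField k (AlgebraicClosure k)))),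
      f (Additive.ofMul (ClassGroup.mulEquiv (AmbiguousClass.intAut
        (absRestrictNormalHom (L₀ ⊔ κ.layer n : IntermediateField k (AlgebraicClosure k)) τ)) c)) =
        absRestrictNormalHom L₀ τ • f (Additive.ofMul c)) :
    f = 0 := by
  letI inst : DistribMulAction (absoluteGaloisGroup k) (cosetKernel H H' (ZMod p)) :=
    DistribMulAction.compHom _ (absRestrictNormalHom L₀)
  have hsmul : ∀ (τ : absoluteGaloisGroup k) (v : cosetKernel H H' (ZMod p)),
      τ • v = absRestrictNormalHom L₀ τ • v := fun _ _ => rfl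
  have hsurj := absRestrictNormalHom_surjective₄ L₀
  have hinjR : ∀ r : ZMod p, Fintype.card H' • r = 0 → r = 0 := zmod_card_nsmul_injective₄ hpH'
  refine EquivariantIwasawaLemma.equivariantHom_classGroup_eq_zero_layer_compositum_tower_of_inertia hp2 κ L₀ hL₀
    hram (V := cosetKernel H H' (ZMod p)) (fun v => ?_) (fun τ hτ v => ?_) (fun μ hμ => ?_)
    (fun 𝔮 _ hp𝔮 w hw => ?_) n f (fun τ c => ?_)
  · -- `p • v = 0`
    refine Subtype.ext (funext fun g => ?_)
    change p • (v.1 g) = 0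
    rw [nsmul_eq_mul, ZMod.natCast_self, zero_mul]
  · -- `Γ_{L₀}` acts trivially
    rw [hsmul, hτ, one_smul]
  · -- (c2*) from (rank)
    exact equivariantHom_cosetKernel_eq_zero_of_natCard_torsion_eq k ↥L₀ H H' hHH' hpH' hrank μ fun σ c => by
      obtain ⟨τ, rfl⟩ := hsurj σ
      rw [hμ τ c, hsmul]
  · -- (c3*-I) from (inertia)
    refine eq_zero_of_forall_smul_eq_of_transitive H H' (ZMod p) hinjR
      (𝔮.inertia (L₀ ≃ₐ[k] L₀) : Set (L₀ ≃ₐ[k] L₀)) (hI 𝔮 hp𝔮) w fun i hi => ?_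
    obtain ⟨τ, hτ⟩ := hsurj i
    have h1 := hw τ (by rw [hτ]; exact hi)
    rw [hsmul, hτ] at h1
    exact h1
  · -- equivariance of `f`
    rw [hf, hsmul]

/-! ### From `Γ_k`-equivariant to `Γ_n`-equivariant characters (Nakayama along `γ̃`) -/

set_option maxHeartbeats 1600000 in
set_option synthInstance.maxHeartbeats 200000 in
/-- **Every `Gal(k̄/K_n)`-equivariant additive `Cl(L₀K_n) → C(G; H ≤ H′)` vanishes** (same hypotheses): with `γ̃ ∈ Γ_k`,
`γ̃|_{L₀} = 1`, `κ(γ̃) = [L₀ : k]`, one has `Γ_k = Gal(k̄/K_n)·γ̃^ℕ` on `L₀K_n`, `γ̃` commutes with `Γ_k` on `L₀K_n`, and `γ̃^{pⁿ}` acts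
trivially on `L₀K_n`; so a `Gal(k̄/K_n)`-equivariant `μ` that is `γ̃`-invariant is `Γ_k`-equivariant, hence zero
(`equivariantHom_cosetKernel_layer_eq_zero`), and the `γ̃`-invariance is removed by
`EquivariantHomNilpotentUpgrade.addMonoidHom_eq_zero_of_forall_invariant_eq_zero`.
[cite: Washington1997, §13.2 Lemma 13.16 and §13.3 (proof of Lemma 13.18)] -/
theorem layerEquivariantHom_cosetKernel_eq_zero (hp2 : p ≠ 2) (κ : ZpExtension k p)
    (L₀ : IntermediateField k (AlgebraicClosure k)) [FiniteDimensional k L₀] [IsGalois k L₀]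
    (hL₀ : ¬ p ∣ Module.finrank k L₀)
    [∀ n, FiniteDimensional k (κ.layer n)] [∀ n, IsGalois k (κ.layer n)]
    [∀ n, NumberField (L₀ ⊔ κ.layer n : IntermediateField k (AlgebraicClosure k))]
    (hram : ∃ 𝔓' : Ideal (absIntegers (𝓞 k) k), 𝔓'.IsMaximal ∧
      𝔓'.inertia (absoluteGaloisGroup k) ⊔ κ.kerSubgroup = ⊤)
    (H H' : Subgroup (L₀ ≃ₐ[k] L₀)) (hHH' : H ≤ H') [Fintype H] [Fintype H'] (hpH' : ¬ p ∣ Fintype.card H')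
    [NumberField L₀]
    (hrank : Nat.card {d : ClassGroup (𝓞 ↥(fixedField H)) // d ^ p = 1} =
      Nat.card {d : ClassGroup (𝓞 ↥(fixedField H')) // d ^ p = 1})
    (hI : ∀ (𝔮 : Ideal (𝓞 L₀)) [𝔮.IsMaximal], ((p : ℕ) : 𝓞 L₀) ∈ 𝔮 →
      ∀ g : L₀ ≃ₐ[k] L₀, ∃ i ∈ 𝔮.inertia (L₀ ≃ₐ[k] L₀), ∃ h ∈ H, g = i * h)
    (n : ℕ)
    (μ : Additive (ClassGroup (𝓞 (L₀ ⊔ κ.layer n : IntermediateField k (AlgebraicClosure k)))) →+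
      cosetKernel H H' (ZMod p))
    (hμ : ∀ τ ∈ κ.layerSubgroup n,
      ∀ c : ClassGroup (𝓞 (L₀ ⊔ κ.layer n : IntermediateField k (AlgebraicClosure k))),
      μ (Additive.ofMul (ClassGroup.mulEquiv (AmbiguousClass.intAut
        (absRestrictNormalHom (L₀ ⊔ κ.layer n : IntermediateField k (AlgebraicClosure k)) τ)) c)) =
        absRestrictNormalHom L₀ τ • μ (Additive.ofMul c)) :
    μ = 0 := by
  classical
  have hpr : p.Prime := hp.out
  haveI hKn : ∀ m, Normal k (κ.layer m) := fun m => inferInstance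
  obtain ⟨γ₁, hγ₁L, hγ₁κ⟩ := exists_restrict_eq_one_toAdd_eq κ L₀
  -- the Galois action on `Additive (Cl (L₀ ⊔ κ.layer n : IntermediateField k (AlgebraicClosure k)))` as a monoid homomorphism `Γ_k →* End`
  let ρE : ((L₀ ⊔ κ.layer n : IntermediateField k (AlgebraicClosure k)) ≃ₐ[k] (L₀ ⊔ κ.layer n : IntermediateField k (AlgebraicClosure k))) →* AddMonoid.End (Additive (ClassGroup (𝓞 (L₀ ⊔ κ.layer n : IntermediateField k (AlgebraicClosure k))))) :=
    { toFun := fun σ => (ClassGroup.mulEquiv (AmbiguousClass.intAut σ)).toMonoidHom.toAdditive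
      map_one' := AddMonoidHom.ext fun a => by
        change Additive.ofMul (ClassGroup.mulEquiv (AmbiguousClass.intAut (1 : (L₀ ⊔ κ.layer n : IntermediateField k (AlgebraicClosure k)) ≃ₐ[k] (L₀ ⊔ κ.layer n : IntermediateField k (AlgebraicClosure k)))) (Additive.toMul a)) = a
        rw [AmbiguousClass.mulEquiv_intAut_one, MulEquiv.refl_apply, ofMul_toMul]
      map_mul' := fun σ τ => AddMonoidHom.ext fun a => by
        change Additive.ofMul (ClassGroup.mulEquiv (AmbiguousClass.intAut (σ * τ)) (Additive.toMul a)) =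
          Additive.ofMul (ClassGroup.mulEquiv (AmbiguousClass.intAut σ)
            (Additive.toMul (Additive.ofMul (ClassGroup.mulEquiv (AmbiguousClass.intAut τ) (Additive.toMul a)))))
        rw [AmbiguousClass.mulEquiv_intAut_mul, MulEquiv.trans_apply, toMul_ofMul] }
  let ρ : absoluteGaloisGroup k →* AddMonoid.End (Additive (ClassGroup (𝓞 (L₀ ⊔ κ.layer n : IntermediateField k (AlgebraicClosure k))))) := ρE.comp (absRestrictNormalHom (L₀ ⊔ κ.layer n : IntermediateField k (AlgebraicClosure k)))
  have hρ : ∀ (τ : absoluteGaloisGroup k) (a : Additive (ClassGroup (𝓞 (L₀ ⊔ κ.layer n : IntermediateField k (AlgebraicClosure k))))),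
      ρ τ a = Additive.ofMul (ClassGroup.mulEquiv (AmbiguousClass.intAut (absRestrictNormalHom (L₀ ⊔ κ.layer n : IntermediateField k (AlgebraicClosure k)) τ))
        (Additive.toMul a)) := fun _ _ => rfl
  have hρ1 : ∀ τ : absoluteGaloisGroup k, absRestrictNormalHom (L₀ ⊔ κ.layer n : IntermediateField k (AlgebraicClosure k)) τ = 1 → ρ τ = 1 := fun τ hτ => by
    change ρE (absRestrictNormalHom (L₀ ⊔ κ.layer n : IntermediateField k (AlgebraicClosure k)) τ) = 1
    rw [hτ, map_one]
  -- `γ̃` is central on `(L₀ ⊔ κ.layer n : IntermediateField k (AlgebraicClosure k))` and `γ̃^{pⁿ}` is trivial on `(L₀ ⊔ κ.layer n : IntermediateField k (AlgebraicClosure k))`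
  have hcomm : ∀ τ : absoluteGaloisGroup k, ρ (γ₁ * τ) = ρ (τ * γ₁) := fun τ => by
    have h1 : absRestrictNormalHom (L₀ ⊔ κ.layer n : IntermediateField k (AlgebraicClosure k)) (γ₁ * τ) = absRestrictNormalHom (L₀ ⊔ κ.layer n : IntermediateField k (AlgebraicClosure k)) (τ * γ₁) := by
      rw [absRestrictNormalHom_sup_eq_iff₄]
      constructor
      · rw [map_mul, map_mul, hγ₁L, one_mul, mul_one]
      · rw [map_mul, map_mul]
        exact (κ.isAbelianGalois_layer n).toIsMulCommutative.is_comm.comm _ _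
    change ρE (absRestrictNormalHom (L₀ ⊔ κ.layer n : IntermediateField k (AlgebraicClosure k)) (γ₁ * τ)) = ρE (absRestrictNormalHom (L₀ ⊔ κ.layer n : IntermediateField k (AlgebraicClosure k)) (τ * γ₁))
    rw [h1]
  set g : AddMonoid.End (Additive (ClassGroup (𝓞 (L₀ ⊔ κ.layer n : IntermediateField k (AlgebraicClosure k))))) := ρ γ₁ with hgdef
  have hgpow : ∀ t : ℕ, g ^ t = ρ (γ₁ ^ t) := fun t => by rw [hgdef, ← map_pow]
  have hg1 : g ^ (p ^ n) = 1 := by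
    rw [hgpow]
    refine hρ1 _ ?_
    rw [absRestrictNormalHom_sup_eq_one_iff₄]
    refine ⟨by rw [map_pow, hγ₁L, one_pow], ?_⟩
    rw [absRestrictNormalHom_layer_eq_one_iff₄, ZpExtension.mem_layerSubgroup, map_pow, toAdd_pow, hγ₁κ, nsmul_eq_mul,
      Nat.cast_pow]
    exact dvd_mul_right ((p : ℤ_[p]) ^ n) (Module.finrank k L₀ : ℤ_[p])
  -- the predicate `P = Γ_n-equivariance`
  let P : (Additive (ClassGroup (𝓞 (L₀ ⊔ κ.layer n : IntermediateField k (AlgebraicClosure k)))) →+ cosetKernel H H' (ZMod p)) → Prop := fun ν =>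
    ∀ τ ∈ κ.layerSubgroup n, ∀ a, ν (ρ τ a) = absRestrictNormalHom L₀ τ • ν a
  have hPμ : P μ := fun τ hτ a => by
    rw [hρ, hμ τ hτ, ofMul_toMul]
  refine addMonoidHom_eq_zero_of_forall_invariant_eq_zero (p := p) (N := p ^ n) (fun v => ?_) g
    (exists_pow_sub_one_apply_eq_nsmul hpr n g hg1) P (fun ν hν τ hτ a => ?_) (fun ν hν hνg => ?_) μ hPμ
  · -- `p • v = 0` on `C`
    refine Subtype.ext (funext fun x => ?_)
    change p • (v.1 x) = 0
    rw [nsmul_eq_mul, ZMod.natCast_self, zero_mul]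
  · -- `P` is stable under `ν ↦ ν ∘ (g - 1)` (centrality of `γ̃`)
    rw [AddMonoidHom.comp_apply, AddMonoidHom.comp_apply]
    change ν (g (ρ τ a) - ρ τ a) = absRestrictNormalHom L₀ τ • ν (g a - a)
    have h1 : g (ρ τ a) = ρ τ (g a) := by
      change (ρ γ₁ * ρ τ) a = (ρ τ * ρ γ₁) a
      rw [← map_mul, ← map_mul, hcomm]
    rw [h1, map_sub, map_sub, hν τ hτ, hν τ hτ, smul_sub]
  · -- a `γ̃`-invariant `Γ_n`-equivariant `ν` is `Γ_k`-equivariant, hence zero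
    have hνgt : ∀ (t : ℕ) (a : Additive (ClassGroup (𝓞 (L₀ ⊔ κ.layer n : IntermediateField k (AlgebraicClosure k))))), ν ((g ^ t) a) = ν a := by
      intro t
      induction t with
      | zero => intro a; rw [pow_zero]; rfl
      | succ t ih => intro a; rw [pow_succ]; change ν ((g ^ t) (g a)) = ν a; rw [ih, hνg]
    refine equivariantHom_cosetKernel_layer_eq_zero hp2 κ L₀ hL₀ hram H H' hHH' hpH' hrank hI n ν fun τ c => ?_
    obtain ⟨t, ht⟩ := exists_mul_pow_inv_mem_layerSubgroup κ hL₀ hγ₁κ n τ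
    have hτ : τ = τ * (γ₁ ^ t)⁻¹ * γ₁ ^ t := by rw [inv_mul_cancel_right]
    have h1 : Additive.ofMul (ClassGroup.mulEquiv (AmbiguousClass.intAut (absRestrictNormalHom (L₀ ⊔ κ.layer n : IntermediateField k (AlgebraicClosure k)) τ)) c) =
        ρ (τ * (γ₁ ^ t)⁻¹) ((g ^ t) (Additive.ofMul c)) := by
      rw [hgpow]
      change _ = (ρ (τ * (γ₁ ^ t)⁻¹) * ρ (γ₁ ^ t)) (Additive.ofMul c)
      rw [← map_mul, ← hτ, hρ, toMul_ofMul]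
    rw [h1, hν _ ht, hνgt]
    congr 1
    rw [map_mul, map_inv, map_pow, hγ₁L, one_pow, inv_one, mul_one]

/-! ### The rank equality at every layer -/

/-- `#Hom(Cl(E), ℤ/p) = #Cl(E)[p]` for a number field `E` (`|Hom(G, ℤ/n)| = |G[n]|`, tree `natCard_addMonoidHom_zmod_right`).
[cite: NeukirchANT1999, Ch. III §1 Prop. (1.6) (ii)] -/
private theorem natCard_addMonoidHom_classGroup_zmod₄ (E : Type) [Field E] [NumberField E] (q : ℕ) [NeZero q] :
    Nat.card (Additive (ClassGroup (𝓞 E)) →+ ZMod q) = Nat.card {d : ClassGroup (𝓞 E) // d ^ q = 1} := by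
  rw [natCard_addMonoidHom_zmod_right]
  refine Nat.card_congr ⟨fun x => ⟨Additive.toMul x.1, ?_⟩, fun d => ⟨Additive.ofMul d.1, ?_⟩, fun _ => rfl, fun _ => rfl⟩
  · have h := AddSubgroup.torsionBy.nsmul_iff.mp x.2
    rwa [← ofMul_toMul x.1, ← ofMul_pow, ofMul_eq_zero] at h
  · exact AddSubgroup.torsionBy.nsmul_iff.mpr (by rw [← ofMul_pow, d.2, ofMul_one])

set_option maxHeartbeats 3200000 in
set_option synthInstance.maxHeartbeats 400000 in
/-- **THE RANK-EQUALITY TRANSFER along the cyclotomic tower.**  `k` a number field, `p` odd, `κ` a `ℤ_p`-extension of `k` with a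
totally ramified prime, `L₀ ⊆ k̄` finite Galois with `G = Gal(L₀/k)`, `p ∤ [L₀ : k]`; `H ≤ H′ ≤ G` with `p ∤ #H′`; (rank)
`#Cl(L₀^H)[p] = #Cl(L₀^{H′})[p]`; (inertia) `G = I(𝔮)·H` for every prime `𝔮 ∋ p` of `L₀`.  Then for every `n`, with `Γ_n = Gal(k̄/K_n)` and
`H̃_n, H̃′_n ≤ Gal(L₀K_n/k)` the restrictions to `L₀K_n` of `{τ ∈ Γ_n : τ|_{L₀} ∈ H}` (resp. `H′`) — whose fixed fields are the layers
`L₀^H K_n ⊆ L₀^{H′}K_n`… wait, `L₀^{H′}K_n ⊆ L₀^H K_n` — one has **`#Cl((L₀K_n)^{H̃_n})[p] = #Cl((L₀K_n)^{H̃′_n})[p]`**.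
(`layerEquivariantHom_cosetKernel_eq_zero` ⟹ `CosetKernelModuleLift.invariant_lift_of_forall_equivariantHom_eq_zero` ⟹ the
`H̃_n`-invariant `𝔽_p`-characters of `Cl(L₀K_n)` are `H̃′_n`-invariant ⟹ equal counts by `ClassGroupFixedHomDescent` and
`HomCounts`.) [cite: Washington1997, §13.3 Lemmas 13.14–13.15 and Thm. 10.4 (proof)]
[cite: NeukirchANT1999, Ch. III §1 Prop. (1.6) (ii), (iv)] [cite: SerreLinearRepresentations1977, §7.2 Thm. 13 (Frobenius reciprocity)] -/
theorem natCard_torsion_classGroup_fixedField_layer_eq (hp2 : p ≠ 2) (κ : ZpExtension k p)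
    (L₀ : IntermediateField k (AlgebraicClosure k)) [FiniteDimensional k L₀] [IsGalois k L₀]
    (hL₀ : ¬ p ∣ Module.finrank k L₀)
    [∀ n, FiniteDimensional k (κ.layer n)] [∀ n, IsGalois k (κ.layer n)]
    [∀ n, NumberField (L₀ ⊔ κ.layer n : IntermediateField k (AlgebraicClosure k))]
    (hram : ∃ 𝔓' : Ideal (absIntegers (𝓞 k) k), 𝔓'.IsMaximal ∧
      𝔓'.inertia (absoluteGaloisGroup k) ⊔ κ.kerSubgroup = ⊤)
    (H H' : Subgroup (L₀ ≃ₐ[k] L₀)) (hHH' : H ≤ H') [Fintype H] [Fintype H'] (hpH' : ¬ p ∣ Fintype.card H')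
    [NumberField L₀]
    (hrank : Nat.card {d : ClassGroup (𝓞 ↥(fixedField H)) // d ^ p = 1} =
      Nat.card {d : ClassGroup (𝓞 ↥(fixedField H')) // d ^ p = 1})
    (hI : ∀ (𝔮 : Ideal (𝓞 L₀)) [𝔮.IsMaximal], ((p : ℕ) : 𝓞 L₀) ∈ 𝔮 →
      ∀ g : L₀ ≃ₐ[k] L₀, ∃ i ∈ 𝔮.inertia (L₀ ≃ₐ[k] L₀), ∃ h ∈ H, g = i * h)
    (n : ℕ)
    (Hn H'n : Subgroup ((L₀ ⊔ κ.layer n : IntermediateField k (AlgebraicClosure k)) ≃ₐ[k] (L₀ ⊔ κ.layer n : IntermediateField k (AlgebraicClosure k)))) [Fintype Hn] [Fintype H'n]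
    (hHn : Hn = (H.comap ((absRestrictNormalHom L₀).comp (κ.layerSubgroup n).subtype)).map
      ((absRestrictNormalHom (L₀ ⊔ κ.layer n : IntermediateField k (AlgebraicClosure k))).comp (κ.layerSubgroup n).subtype))
    (hH'n : H'n = (H'.comap ((absRestrictNormalHom L₀).comp (κ.layerSubgroup n).subtype)).map
      ((absRestrictNormalHom (L₀ ⊔ κ.layer n : IntermediateField k (AlgebraicClosure k))).comp (κ.layerSubgroup n).subtype)) :
    Nat.card {d : ClassGroup (𝓞 ↥(fixedField Hn)) // d ^ p = 1} =
      Nat.card {d : ClassGroup (𝓞 ↥(fixedField H'n)) // d ^ p = 1} := by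
  classical
  have hpr : p.Prime := hp.out
  haveI : NeZero p := ⟨hpr.ne_zero⟩
  haveI hKn : ∀ m, Normal k (κ.layer m) := fun m => inferInstance
  obtain ⟨γ₁, hγ₁L, hγ₁κ⟩ := exists_restrict_eq_one_toAdd_eq κ L₀
  have hsurjL₀ := absRestrictNormalHom_surjective₄ L₀
  set πn : ↥(κ.layerSubgroup n) →* (L₀ ≃ₐ[k] L₀) :=
    (absRestrictNormalHom L₀).comp (κ.layerSubgroup n).subtype with hπndef
  set resn : ↥(κ.layerSubgroup n) →* ((L₀ ⊔ κ.layer n : IntermediateField k (AlgebraicClosure k)) ≃ₐ[k] (L₀ ⊔ κ.layer n : IntermediateField k (AlgebraicClosure k))) :=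
    (absRestrictNormalHom (L₀ ⊔ κ.layer n : IntermediateField k (AlgebraicClosure k))).comp (κ.layerSubgroup n).subtype with hresndef
  have hπn : ∀ τ : ↥(κ.layerSubgroup n), πn τ = absRestrictNormalHom L₀ (τ : absoluteGaloisGroup k) := fun _ => rfl
  have hresn : ∀ τ : ↥(κ.layerSubgroup n), resn τ = absRestrictNormalHom (L₀ ⊔ κ.layer n : IntermediateField k (AlgebraicClosure k)) (τ : absoluteGaloisGroup k) :=
    fun _ => rfl
  -- `resn τ = resn τ' ↔ πn τ = πn τ'` (an automorphism of `L₀K_n` trivial on `K_n` is determined on `L₀`)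
  have hres_iff : ∀ τ τ' : ↥(κ.layerSubgroup n), resn τ = resn τ' ↔ πn τ = πn τ' := fun τ τ' => by
    rw [hresn, hresn, hπn, hπn, absRestrictNormalHom_sup_eq_iff₄]
    constructor
    · exact fun h => h.1
    · intro h
      refine ⟨h, ?_⟩
      rw [(absRestrictNormalHom_layer_eq_one_iff₄ κ n _).mpr τ.2, (absRestrictNormalHom_layer_eq_one_iff₄ κ n _).mpr τ'.2]
  -- `πn` is onto, with a section `s`
  have hπsurj : Function.Surjective πn := fun g => by
    obtain ⟨τ₀, hτ₀⟩ := hsurjL₀ g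
    obtain ⟨t, ht⟩ := exists_mul_pow_inv_mem_layerSubgroup κ hL₀ hγ₁κ n τ₀
    refine ⟨⟨τ₀ * (γ₁ ^ t)⁻¹, ht⟩, ?_⟩
    rw [hπn]
    change absRestrictNormalHom L₀ (τ₀ * (γ₁ ^ t)⁻¹) = g
    rw [map_mul, map_inv, map_pow, hγ₁L, one_pow, inv_one, mul_one, hτ₀]
  set s : (L₀ ≃ₐ[k] L₀) → ↥(κ.layerSubgroup n) := Function.surjInv hπsurj with hsdef
  have hs : ∀ g, πn (s g) = g := Function.surjInv_eq hπsurj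
  -- cardinalities `#S̃n = #S`
  have hcardS : ∀ (S : Subgroup (L₀ ≃ₐ[k] L₀)) (Sn : Subgroup ((L₀ ⊔ κ.layer n : IntermediateField k (AlgebraicClosure k)) ≃ₐ[k] (L₀ ⊔ κ.layer n : IntermediateField k (AlgebraicClosure k)))) [Fintype S] [Fintype Sn],
      Sn = (S.comap πn).map resn → Fintype.card Sn = Fintype.card S := by
    intro S Sn _ _ hSn
    apply le_antisymm
    · -- `Sn ↪ S`
      have hex : ∀ y : Sn, ∃ τ : ↥(κ.layerSubgroup n), πn τ ∈ S ∧ resn τ = y.1 := fun y => by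
        have hy : y.1 ∈ (S.comap πn).map resn := by rw [← hSn]; exact y.2
        rw [Subgroup.mem_map] at hy
        obtain ⟨τ, hτ, hτy⟩ := hy
        exact ⟨τ, Subgroup.mem_comap.mp hτ, hτy⟩
      choose τy hτyS hτyres using hex
      refine Fintype.card_le_of_injective (fun y => (⟨πn (τy y), hτyS y⟩ : S)) fun y y' hyy' => ?_
      have h1 : πn (τy y) = πn (τy y') := congrArg Subtype.val hyy'
      rw [← hres_iff, hτyres, hτyres] at h1
      exact Subtype.ext h1
    · -- `S ↪ Sn`
      have hmem : ∀ x : S, resn (s x) ∈ Sn := fun x => by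
        rw [hSn, Subgroup.mem_map]
        exact ⟨s x, Subgroup.mem_comap.mpr (by rw [hs]; exact x.2), rfl⟩
      refine Fintype.card_le_of_injective (fun x => (⟨resn (s x), hmem x⟩ : Sn)) fun x x' hxx' => ?_
      have h1 : resn (s x) = resn (s x') := congrArg Subtype.val hxx'
      rw [hres_iff, hs, hs] at h1
      exact Subtype.ext h1
  have hpH : ¬ p ∣ Fintype.card H := fun h =>
    hpH' (h.trans (by simpa [← Nat.card_eq_fintype_card] using Subgroup.card_dvd_of_le hHH'))
  have hpHn : ¬ p ∣ Fintype.card Hn := by rw [hcardS H Hn hHn]; exact hpH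
  have hpH'n : ¬ p ∣ Fintype.card H'n := by rw [hcardS H' H'n hH'n]; exact hpH'
  have hHnle : Hn ≤ H'n := by
    rw [hHn, hH'n]
    exact Subgroup.map_mono (Subgroup.comap_mono hHH')
  -- the action `ρn : Γ_n → End (Additive Cl(L₀K_n))`
  let ρE : ((L₀ ⊔ κ.layer n : IntermediateField k (AlgebraicClosure k)) ≃ₐ[k] (L₀ ⊔ κ.layer n : IntermediateField k (AlgebraicClosure k))) →* AddMonoid.End (Additive (ClassGroup (𝓞 (L₀ ⊔ κ.layer n : IntermediateField k (AlgebraicClosure k))))) :=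
    { toFun := fun σ => (ClassGroup.mulEquiv (AmbiguousClass.intAut σ)).toMonoidHom.toAdditive
      map_one' := AddMonoidHom.ext fun a => by
        change Additive.ofMul (ClassGroup.mulEquiv (AmbiguousClass.intAut (1 : (L₀ ⊔ κ.layer n : IntermediateField k (AlgebraicClosure k)) ≃ₐ[k] (L₀ ⊔ κ.layer n : IntermediateField k (AlgebraicClosure k))))
          (Additive.toMul a)) = a
        rw [AmbiguousClass.mulEquiv_intAut_one, MulEquiv.refl_apply, ofMul_toMul]
      map_mul' := fun σ τ => AddMonoidHom.ext fun a => by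
        change Additive.ofMul (ClassGroup.mulEquiv (AmbiguousClass.intAut (σ * τ)) (Additive.toMul a)) =
          Additive.ofMul (ClassGroup.mulEquiv (AmbiguousClass.intAut σ)
            (Additive.toMul (Additive.ofMul (ClassGroup.mulEquiv (AmbiguousClass.intAut τ) (Additive.toMul a)))))
        rw [AmbiguousClass.mulEquiv_intAut_mul, MulEquiv.trans_apply, toMul_ofMul] }
  let ρn : ↥(κ.layerSubgroup n) →* AddMonoid.End (Additive (ClassGroup (𝓞 (L₀ ⊔ κ.layer n : IntermediateField k (AlgebraicClosure k))))) := ρE.comp resn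
  have hρn : ∀ (τ : ↥(κ.layerSubgroup n)) (a : Additive (ClassGroup (𝓞 (L₀ ⊔ κ.layer n : IntermediateField k (AlgebraicClosure k))))),
      ρn τ a = Additive.ofMul (ClassGroup.mulEquiv (AmbiguousClass.intAut (resn τ)) (Additive.toMul a)) :=
    fun _ _ => rfl
  -- every `Γ_n`-equivariant `μ : Cl(L₀K_n) → C` vanishes
  have hvan : ∀ μ : Additive (ClassGroup (𝓞 (L₀ ⊔ κ.layer n : IntermediateField k (AlgebraicClosure k)))) →+ cosetKernel H H' (ZMod p),
      (∀ (τ : ↥(κ.layerSubgroup n)) (a : Additive (ClassGroup (𝓞 (L₀ ⊔ κ.layer n : IntermediateField k (AlgebraicClosure k))))), μ (ρn τ a) = πn τ • μ a) → μ = 0 :=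
    fun μ hμ => layerEquivariantHom_cosetKernel_eq_zero hp2 κ L₀ hL₀ hram H H' hHH' hpH' hrank hI n μ
      fun τ hτ c => by
        have h1 := hμ ⟨τ, hτ⟩ (Additive.ofMul c)
        rw [hρn, toMul_ofMul] at h1
        exact h1
  -- an inverse of `#H′` in `ℤ/p`
  have hunit : IsUnit ((Fintype.card H' : ℕ) : ZMod p) := by
    rw [isUnit_iff_ne_zero, Ne, ZMod.natCast_eq_zero_iff]; exact hpH'
  obtain ⟨w, hw⟩ := hunit
  let u : ℤ := ((w⁻¹ : (ZMod p)ˣ) : ZMod p).val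
  have hu : ∀ r : ZMod p, u • (Fintype.card H' • r) = r := fun r => by
    rw [nsmul_eq_mul, zsmul_eq_mul, ← mul_assoc]
    have h1 : ((u : ℤ) : ZMod p) * (Fintype.card H' : ZMod p) = 1 := by
      change (((((w⁻¹ : (ZMod p)ˣ) : ZMod p).val : ℕ) : ℤ) : ZMod p) * _ = 1
      rw [Int.cast_natCast, ZMod.natCast_zmod_val, ← hw, Units.inv_mul]
    rw [h1, one_mul]
  -- FROBENIUS: `π⁻¹H`-invariant characters are `π⁻¹H′`-invariant
  have hinv := invariant_lift_of_forall_equivariantHom_eq_zero H H' (ZMod p) πn ρn hHH' s hs u hu hvan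
  -- translation between the two forms of invariance
  have hform₁ : ∀ (S : Subgroup (L₀ ≃ₐ[k] L₀)) (Sn : Subgroup ((L₀ ⊔ κ.layer n : IntermediateField k (AlgebraicClosure k)) ≃ₐ[k] (L₀ ⊔ κ.layer n : IntermediateField k (AlgebraicClosure k)))),
      Sn = (S.comap πn).map resn → ∀ ν : Additive (ClassGroup (𝓞 (L₀ ⊔ κ.layer n : IntermediateField k (AlgebraicClosure k)))) →+ ZMod p,
      (∀ h ∈ Sn, ∀ c : ClassGroup (𝓞 (L₀ ⊔ κ.layer n : IntermediateField k (AlgebraicClosure k))),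
        ν (Additive.ofMul (ClassGroup.mulEquiv (AmbiguousClass.intAut h) c)) = ν (Additive.ofMul c)) ↔
      (∀ τ : ↥(κ.layerSubgroup n), πn τ ∈ S → ∀ a, ν (ρn τ a) = ν a) := by
    intro S Sn hSn ν
    constructor
    · intro hν τ hτ a
      have hmem : resn τ ∈ Sn := by
        rw [hSn, Subgroup.mem_map]; exact ⟨τ, Subgroup.mem_comap.mpr hτ, rfl⟩
      rw [hρn]
      have h1 := hν _ hmem (Additive.toMul a)
      rwa [ofMul_toMul] at h1
    · intro hν h hh c
      rw [hSn, Subgroup.mem_map] at hh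
      obtain ⟨τ, hτ, rfl⟩ := hh
      have h1 := hν τ (Subgroup.mem_comap.mp hτ) (Additive.ofMul c)
      rwa [hρn, toMul_ofMul] at h1
  -- counting
  have hcount : ∀ (Sn : Subgroup ((L₀ ⊔ κ.layer n : IntermediateField k (AlgebraicClosure k)) ≃ₐ[k] (L₀ ⊔ κ.layer n : IntermediateField k (AlgebraicClosure k)))) [Fintype Sn], ¬ p ∣ Fintype.card Sn →
      Nat.card {ν : Additive (ClassGroup (𝓞 (L₀ ⊔ κ.layer n : IntermediateField k (AlgebraicClosure k)))) →+ ZMod p // ∀ h ∈ Sn, ∀ c : ClassGroup (𝓞 (L₀ ⊔ κ.layer n : IntermediateField k (AlgebraicClosure k))),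
        ν (Additive.ofMul (ClassGroup.mulEquiv (AmbiguousClass.intAut h) c)) = ν (Additive.ofMul c)} =
      Nat.card {d : ClassGroup (𝓞 ↥(fixedField Sn)) // d ^ p = 1} := by
    intro Sn _ hpSn
    rw [natCard_fixed_addMonoidHom_classGroup_eq k (L₀ ⊔ κ.layer n : IntermediateField k (AlgebraicClosure k)) Sn
      (fun v : ZMod p => by rw [nsmul_eq_mul, ZMod.natCast_self, zero_mul])
      ((Nat.Prime.coprime_iff_not_dvd hpr).mpr hpSn), natCard_addMonoidHom_classGroup_zmod₄]
  -- the bijection `{H̃′_n-invariant} → {H̃_n-invariant}`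
  haveI : Finite (Additive (ClassGroup (𝓞 (L₀ ⊔ κ.layer n : IntermediateField k (AlgebraicClosure k))))) := Finite.of_equiv _ Additive.ofMul
  haveI : Finite (Additive (ClassGroup (𝓞 (L₀ ⊔ κ.layer n : IntermediateField k (AlgebraicClosure k)))) →+ ZMod p) := Finite.of_injective _ DFunLike.coe_injective
  let ι : {ν : Additive (ClassGroup (𝓞 (L₀ ⊔ κ.layer n : IntermediateField k (AlgebraicClosure k)))) →+ ZMod p // ∀ h ∈ H'n, ∀ c : ClassGroup (𝓞 (L₀ ⊔ κ.layer n : IntermediateField k (AlgebraicClosure k))),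
        ν (Additive.ofMul (ClassGroup.mulEquiv (AmbiguousClass.intAut h) c)) = ν (Additive.ofMul c)} →
      {ν : Additive (ClassGroup (𝓞 (L₀ ⊔ κ.layer n : IntermediateField k (AlgebraicClosure k)))) →+ ZMod p // ∀ h ∈ Hn, ∀ c : ClassGroup (𝓞 (L₀ ⊔ κ.layer n : IntermediateField k (AlgebraicClosure k))),
        ν (Additive.ofMul (ClassGroup.mulEquiv (AmbiguousClass.intAut h) c)) = ν (Additive.ofMul c)} :=
    fun ν => ⟨ν.1, fun h hh c => ν.2 h (hHnle hh) c⟩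
  have hι : Function.Bijective ι := by
    refine ⟨fun ν ν' h => Subtype.ext (by simpa [ι] using congrArg Subtype.val h), fun ν => ?_⟩
    have h1 := (hform₁ H Hn hHn ν.1).mp ν.2
    have h2 := hinv ν.1 h1
    exact ⟨⟨ν.1, (hform₁ H' H'n hH'n ν.1).mpr h2⟩, rfl⟩
  rw [← hcount Hn hpHn, ← hcount H'n hpH'n]
  exact (Nat.card_eq_of_bijective ι hι).symm

end RankEqualityTransfer

end Literature.NumberTheory.NumberFields

end
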